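import Summits.CriticalPhenomena.SAWScalingLimit.Theorems.SAWLoopFugacityFlowSimpleSubseqLimitsLineGlue
import Summits.CriticalPhenomena.SAWScalingLimit.Theorems.SAWLoopFugacityFlowSimpleSubseqLimitsStubShadowing
import Summits.CriticalPhenomena.SAWScalingLimit.Theorems.SAWLoopFugacityFlowSimpleSubseqLimitsStubMarked
import Summits.CriticalPhenomena.SAWScalingLimit.Theorems.SAWLoopFugacityFlowSimpleSubseqLimitsStubPassage
import Summits.CriticalPhenomena.SAWScalingLimit.Theorems.SAWLoopFugacityFlowSimpleSubseqLimitsStubRangeIsArc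
import Summits.CriticalPhenomena.SAWScalingLimit.Theorems.SimpleSubseqLimits.Negative.SimpleSubseqLimitsNecessary
import HarnessLib

/-!
# Line `marked-point-revisit` — MAIN THEOREM: the crux `SimpleSubseqLimits` from ONE open lattice input and the route's A-side
(stmt-CriticalPhenomena-4982; lead prover; registered obligation `line_main`)

With every provable stub of the line LANDED — the two deterministic lemmas (`Shadowing.stub_shadowing`,
`Marked.stub_markedOfShadowing`), the limit passage (`Passage.stub_noMarkedRevisit`), and the whole
SHAPE transfer (`ArcRange.stub_rangeIsArc_transfer`, `ArcRangeBoundary.stub_rangeIsArc_boundary`,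
`ArcRangeTests.stub_rangeIsArc_tests` with its helpers, glued by the ArcRange worker into
`ArcRangeGlue.stub_rangeIsArc`) — and `SLECarrier` a theorem of
the tree (`IsSLELaw.isProbabilityMeasure` + the landed `Negative.ae_carrier_of_isSLELaw`, discharged inline
below), the landed composition
`Glue.line_glue` yields:

  `line_main : (∀ D a b, IsEndpointApprox D a b → NoTouchAt D a b) → AvoidanceLimit → AvoidancePassage →
     SLEAvoidanceValue → SimpleSubseqLimits`.

So the crux is reduced to (i) the route's avoidance items — the open rank-2 crux `AvoidanceLimit`
(stmt-10649) and the two provable-now supports `AvoidancePassage` (stmt-4984), `SLEAvoidanceValue`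
(stmt-10651) — and (ii) ONE lattice estimate `NoTouchAt` (one-point no-touch for the critical SAW in its
weakest typed, thickened first-approach form), which is necessary given `EventualTight`
(`Negative/SimpleSubseqLimitsThickeningNecessity.lean`) and implied by the summit conjunct.
-/

noncomputable section

open MeasureTheory Filter Topology Set Metric
open Literature.Probability.RandomPlanarGeometry Literature.Probability.LatticeModels
open UpperHalfPlane (upperHalfPlaneSet)
open scoped ENNReal NNReal BoundedContinuousFunction unitInterval

namespace Summit.CriticalPhenomena.SAWScalingLimit.Theorems.SimpleSubseqLimits.MarkedPointRevisit.Main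

open Summit.CriticalPhenomena.SAWScalingLimit.Theses.SAWLoopFugacityFlow
  (SimpleSubseqLimits AvoidanceLimit AvoidancePassage SLEAvoidanceValue SLECarrier)
open Summit.CriticalPhenomena.SAWScalingLimit.Theorems.SimpleSubseqLimits.MarkedPointRevisit.Glue
  (NoTouchAt line_glue)

/-- **MAIN THEOREM OF THE LINE (registered obligation `line_main`).** The crux `SimpleSubseqLimits` follows
from ONE lattice estimate — the one-point no-touch bound `NoTouchAt` for the critical SAW along every
endpoint approximation — together with the route's avoidance items `AvoidanceLimit`, `AvoidancePassage`,
`SLEAvoidanceValue`; everything else (deterministic shadowing lemmas, the portmanteau passage, the SHAPE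
transfer, `SLECarrier` — discharged inline) is PROVED in the tree. [folklore] -/
theorem line_main :
    (∀ (D : DobrushinDomain) (a b : ℝ → Site 2), SAW.IsEndpointApprox D a b → NoTouchAt D a b) →
    AvoidanceLimit → AvoidancePassage → SLEAvoidanceValue → SimpleSubseqLimits :=
  fun hOP hA hP hV =>
    line_glue Shadowing.stub_shadowing Marked.stub_markedOfShadowing ArcRangeGlue.stub_rangeIsArc
      Passage.stub_noMarkedRevisit hOP hA hP hV (by
        -- `SLECarrier` (route item stmt-4985) holds: `IsSLELaw.isProbabilityMeasure` (projective-limit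
        -- construction of the pre-Wiener measure, `isProjectiveLimit_preWienerMeasure_holds`) and the
        -- landed carrier lemma `Negative.ae_carrier_of_isSLELaw` (Rohde–Schramm simplicity for κ ≤ 4,
        -- Carathéodory endpoints); cf. the refuter's `sleCarrier_holds`, Disproof §3.
        intro D μ hμ
        haveI : Fact Literature.Probability.Process.isProjectiveLimit_preWienerMeasure :=
          ⟨isProjectiveLimit_preWienerMeasure_holds⟩
        exact ⟨hμ.isProbabilityMeasure,
          Summit.CriticalPhenomena.SAWScalingLimit.Theorems.SimpleSubseqLimits.Negative.ae_carrier_of_isSLELaw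
            hμ⟩)

end Summit.CriticalPhenomena.SAWScalingLimit.Theorems.SimpleSubseqLimits.MarkedPointRevisit.Main

end
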